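import Summits.Ventures.HSemireg.AmplificationChainPridhamPerfect
import Mathlib.CategoryTheory.Limits.Shapes.Pullback.Mono
import HarnessLib

/-!
# Venture HSemireg — the OBJECT-LEVEL étale shape behind route (C)'s Hodge-free algebraisation
# assumption: «`E` extends, up to quasi-isomorphism at the marked point, to a bounded complex of vector
# bundles over an étale neighbourhood of `s₀`» ⟹ (KERNEL) the CLASS-LEVEL conclusion of
# `PerfectComplexAlgebraisesLifts C` in every degree, for every Chern character theory `C`

HONEST FRAMING. Lean index of the computation cell `pub-hsemireg` (theory seat 3, «algebraisation step»).
Nothing about any explicit variety is asserted; nothing here says HC, HC_CM or HC_AV is proved. TWO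
definitions, both PREDICATES with parameters (a local conclusion shape and its family-level wrapper —
definitions with bodies, NOT named facts), theorems otherwise; no `sorry`, no new axiom, no Literature fact
declared.

## What this file does

Seat p7's `AmplificationChainPridhamPerfect.lean` splits route (C)'s one deformation assumption into the
printed Hodge-theoretic statement `PridhamPerfectLifts C` and the Hodge-free algebraisation assumption
`PerfectComplexAlgebraisesLifts C`, whose CONCLUSION is stated at the level of CLASSES (the fibre class of
`ch_p(ℰ)` over `t₀`, carried to `𝒳_{s₀}`, equals `(e⁻¹)^* ch_p(E)` for every `p`) and whose on-paper
derivation ([Lieblich2006] Thm. 4.2.1 + [EGAIV4] 17.14.2 / 17.16.3 (i) + [ThomasonTrobaugh1990] 2.3.1 (d), in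
the printed shape of [Perry2022]'s proof of Prop. 8.1) ends with an OBJECT: a bounded complex of vector
bundles `ℰ` on `𝒳 ×_S T`, `T → S` étale, whose restriction to the fibre over `t₀` is QUASI-ISOMORPHIC to `E`
(«the base change `𝓜°_{U′} → U′` admits a section taking `0′` to `E_{0′}`», [Perry2022] p. 28). The passage
OBJECT ⟹ CLASSES («Chern characters along `X₀ ≅ (𝒳 ×_S T)_{t₀}` agree») was left to the module docstring
there. THIS FILE puts that passage in the kernel:

* §1 `fiberClass_baseChange_chPerfect_eq_of_quasiIso` (PROVED, Hodge-free, deformation-free): for ANY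
  `ρ : T ⟶ S`, `t₀ ∈ T(ℂ)`, a model `e : X₀ ≅ 𝒳_{ρ t₀}` factoring as `X₀ ≅^ε (𝒳 ×_S T)_{t₀} ≅ 𝒳_{ρ t₀}`, a
  bounded complex of vector bundles `ℰ` on `𝒳 ×_S T` and a ROOF of quasi-isomorphisms
  `E ←ψ P →φ (ε ≫ ι_{t₀})^* ℰ` through a bounded complex of vector bundles `P` on `X₀`: the fibre class of
  `ch_p(ℰ)` over `t₀`, carried to `𝒳_{ρ t₀}`, IS `(e⁻¹)^* ch_p(E)` — by p4's `map_chPerfect` (pull-back) and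
  `chPerfect_eq_of_quasiIso` (twice) and the functoriality of `complexBetti`. The roof (rather than a derived-
  category isomorphism) is the shape p4's `chPerfect_eq_of_quasiIso` consumes; on the projective `X₀` every
  isomorphism in `D(Mod 𝒪_{X₀})` between bounded complexes of vector bundles is such a roof
  ([ThomasonTrobaugh1990] 2.3.1 (d) with 2.4.1; not needed in the kernel).
* §2 `PerfectComplexExtendsOverEtaleNbhdAt π s₀ X₀ e E` (def, PREDICATE — a conclusion shape with a body, like
  seat lit-3's `LiftsOverArtinianPointsAt` and seat p7's `PerfectLiftsOverArtinianPointsAt`): an ÉTALE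
  `ρ : T ⟶ S`, `t₀ ↦ s₀`, a bounded complex of vector bundles `ℰ` on `𝒳 ×_S T`, an identification
  `ε : X₀ ≅ (𝒳 ×_S T)_{t₀}` compatible with `e` THROUGH `𝒳` (`ε ≫ ι_{t₀} ≫ pr_𝒳 = e ≫ ι_{s₀}` — no transport
  along `ρ t₀ = s₀` needed), and a roof of quasi-isomorphisms `E ← P → (ε ≫ ι_{t₀})^* ℰ` through a bounded
  complex of vector bundles. `PerfectLiftsAlgebraise π` (def, PREDICATE on a family): every bounded complex
  of vector bundles on a model of a fibre with `Ext^{<0} = 0` and the derived small-extension lifting property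
  (p7's `PerfectLiftsOverArtinianPointsAt`) satisfies `PerfectComplexExtendsOverEtaleNbhdAt`. This is the
  OBJECT-LEVEL form of p7's (E)+(C); its on-paper derivation for smooth projective `π` over a smooth `S` is
  theory seat 3's (D1)–(D5) (cell file `theory/TH3-ALGEBRAISATION.md` §8); the kernel links it to nothing.
* §3 `perfectComplexAlgebraisesLifts_of_perfectLiftsAlgebraise` (PROVED): if `PerfectLiftsAlgebraise π`
  holds for every smooth projective `π` over a smooth base, then `PerfectComplexAlgebraisesLifts C` for
  EVERY `C` — so p7's g = 4 σ-row runs on `PridhamPerfectLifts C` + the object-level, `C`-free hypothesis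
  (`weilFourfoldsSplit_of_reach_of_pridhamPerfect_of_perfectLiftsAlgebraise_of_complex`, every other
  binder verbatim).

STATUS WORDS (cell rules F-1 / W-4). `PerfectLiftsAlgebraise π` is an ASSUMPTION BY NAME exactly as
`PerfectComplexAlgebraisesLifts C` was — standard Hodge-free deformation theory, assembled from refereed /
classical print, kernel-linked to nothing; what the file buys is that the assumption is now stated where the
printed argument ends (an OBJECT over an étale neighbourhood) and is independent of the Chern character
theory `C`, the class-level bookkeeping being a theorem. A Sunday seat proving `PerfectLiftsAlgebraise π`
from a Lieblich-type versal chart and the EGA IV 17 étale quasi-section would make the (E)+(C) half of the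
Monday σ-row a tree theorem modulo those two cited statements.

References: [Perry2022] A. Perry, Compositio Math. 158 (2022), proof of Prop. 8.1 (p. 28) · [Lieblich2006]
J. Algebraic Geom. 15 (2006), Thm. 4.2.1, Prop. 2.1.9 · [EGAIV4] Publ. Math. IHÉS 32 (1967), Prop. 17.14.2,
Cor. 17.16.3 (i) · [ThomasonTrobaugh1990] Prop. 2.3.1 (d), 2.4.1 · [Fulton1998] §15.1 (ii) (p4's `map_chPerfect`)
· [Schlichting2011HigherKTheory] Ex. 3.1.4 (p4's `chPerfect_eq_of_quasiIso`) · [BuchweitzFlenner2003] §5,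
proof of Thm. 5.1 · [Pridham2024Semiregularity] Cor. 2.25, Rem. 2.27 · [Markman2023GeneralizedKummers] Thm. 1.5 (= Thm. 13.4;
J. Eur. Math. Soc. 25 (2023) p. 236; pre-publication arXiv numbering: Thm. 1.3).
-/

noncomputable section

open CategoryTheory CategoryTheory.Limits AlgebraicGeometry
open _root_.Topology _root_.Filter
open Literature.AlgebraicGeometry.Motives Literature.AlgebraicGeometry.HodgeTheory
open Literature.AlgebraicGeometry.ModuliOfAbelianVarieties Literature.AlgebraicGeometry.Deligne1982
open Literature.AlgebraicGeometry.KTheory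
open Literature.AlgebraicTopology.SingularHomology

namespace Summit.Ventures.HSemireg

open Summit.HodgeConjecture.HodgeConjecture
open Summit.HodgeConjecture.HodgeConjecture.WeilTypeLadder
open Summit.HodgeConjecture.HodgeConjecture.Cruxes.HodgeAbelianVarieties.EStepSecantInduction

/-! ## §1 OBJECT ⟹ CLASSES over a base change, at a point (proved; no deformation theory) -/

section FibreClass

variable (C : ChernCharacterBetti) {𝒳 S T : SchemeOver ℂ} (π : 𝒳 ⟶ S) (ρ : T ⟶ S)

/-- **The fibre class of `ch_p(ℰ)` over `t₀`, carried to `𝒳_{ρ t₀}`, is `(e⁻¹)^* ch_p(E)` when `E` is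
quasi-isomorphic (through a roof of bounded complexes of vector bundles) to the restriction of `ℰ` to
`X₀ ≅ (𝒳 ×_S T)_{t₀}`.** Binders: any `ρ : T ⟶ S` and `t₀ ∈ T(ℂ)`; `e : X₀ ≅ 𝒳_{ρ t₀}` factoring as
`ε ≫ ((𝒳 ×_S T)_{t₀} ≅ 𝒳_{ρ t₀})`; bounded complexes of vector bundles `E`, `P` on `X₀` and `ℰ` on `𝒳 ×_S T`;
quasi-isomorphisms `φ : P → (ε ≫ ι_{t₀})^* ℰ` and `ψ : P → E`. Proof: `(ε ≫ ι_{t₀})^* ch_p(ℰ) = ch_p((ε ≫ ι_{t₀})^* ℰ)`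
(`map_chPerfect`) `= ch_p(P) = ch_p(E)` (`chPerfect_eq_of_quasiIso`), then functoriality of `complexBetti.map`
along `e⁻¹ = (…)⁻¹ ≫ ε⁻¹`. [cite: Fulton1998, §15.1 (ii)] [cite: Schlichting2011HigherKTheory, Exercise 3.1.4] -/
theorem fiberClass_baseChange_chPerfect_eq_of_quasiIso (t₀ : ComplexPoints T) (X₀ : SchemeOver ℂ)
    (e : X₀ ≅ fiberOver π (AlgPoints.map ρ t₀)) (ε : X₀ ≅ fiberOver (familyPullback.snd π ρ) t₀)
    (hεe : ε.hom ≫ (fiberOverFamilyPullbackIso π ρ t₀).hom = e.hom)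
    (E : CochainComplex X₀.left.Modules ℤ) (hE : IsBoundedVBComplex E)
    (ℰ : CochainComplex (familyPullback π ρ).left.Modules ℤ) (hℰ : IsBoundedVBComplex ℰ)
    (P : CochainComplex X₀.left.Modules ℤ) (hP : IsBoundedVBComplex P)
    (φ : P ⟶ ((Scheme.Modules.pullback (ε.hom ≫ fiberι (familyPullback.snd π ρ) t₀).left).mapHomologicalComplex
      (ComplexShape.up ℤ)).obj ℰ) [QuasiIso φ]
    (ψ : P ⟶ E) [QuasiIso ψ] (p : ℕ) :
    FiberClass.baseChange π ρ (2 * p)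
        (globalSection (familyPullback.snd π ρ) (2 * p)
          (chPerfect C (familyPullback π ρ) ℰ hℰ.isFiniteLocallyFree p) t₀) =
      ⟨AlgPoints.map ρ t₀, complexBetti.map e.inv (2 * p) (chPerfect C X₀ E hE.isFiniteLocallyFree p)⟩ := by
  -- the class of the restriction of `ℰ` along `ε ≫ ι_{t₀}` is `ch_p(E)`
  have key : complexBetti.map (ε.hom ≫ fiberι (familyPullback.snd π ρ) t₀) (2 * p)
      (chPerfect C (familyPullback π ρ) ℰ hℰ.isFiniteLocallyFree p) =
        chPerfect C X₀ E hE.isFiniteLocallyFree p := by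
    rw [map_chPerfect C (familyPullback π ρ) _ hℰ p, ← chPerfect_eq_of_quasiIso C X₀ hP (hℰ.pullback _) φ p,
      chPerfect_eq_of_quasiIso C X₀ hP hE ψ p]
  have he : e = ε ≪≫ fiberOverFamilyPullbackIso π ρ t₀ := Iso.ext hεe.symm
  -- unfold the transfer of the global section at `t₀`
  change (⟨AlgPoints.map ρ t₀, complexBetti.map (fiberOverFamilyPullbackIso π ρ t₀).inv (2 * p)
      (complexBetti.map (fiberι (familyPullback.snd π ρ) t₀) (2 * p)
        (chPerfect C (familyPullback π ρ) ℰ hℰ.isFiniteLocallyFree p))⟩ : FiberClass π (2 * p)) = _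
  rw [he, Iso.trans_inv, complexBetti.map_comp, ModuleCat.comp_apply, ← key, complexBetti.map_comp,
    ModuleCat.comp_apply, ← ModuleCat.comp_apply (complexBetti.map ε.hom (2 * p)) (complexBetti.map ε.inv (2 * p)),
    ← complexBetti.map_comp, Iso.inv_hom_id, complexBetti.map_id, ModuleCat.id_apply]

end FibreClass

/-! ## §2 The OBJECT-LEVEL étale shape (predicates) -/

section Defs

/-- **`E` extends, up to quasi-isomorphism at the marked point, to a bounded complex of vector bundles over an
ÉTALE NEIGHBOURHOOD of `s₀`** (PREDICATE — a conclusion shape, nothing asserted): for the family `π : 𝒳 ⟶ S`,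
`s₀ ∈ S(ℂ)`, a model `e : X₀ ≅ 𝒳_{s₀}` and a cochain complex `E` on `X₀` there are an étale `ρ : T ⟶ S`, a point
`t₀ ∈ T(ℂ)` over `s₀`, a bounded complex of vector bundles `ℰ` on `𝒳 ×_S T`, an isomorphism
`ε : X₀ ≅ (𝒳 ×_S T)_{t₀}` compatible with `e` through `𝒳` (`ε ≫ ι_{t₀} ≫ pr_𝒳 = e ≫ ι_{s₀}`), and a ROOF of
quasi-isomorphisms `E ← P → (ε ≫ ι_{t₀})^* ℰ` through a bounded complex of vector bundles `P` on `X₀` (the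
TERMWISE pull-back `(ε ≫ ι_{t₀})^*` of a bounded complex of vector bundles IS the derived one, the terms being flat — so
«extends up to quasi-isomorphism» is the faithful reading; theory seat 2's remark). This is the
printed conclusion shape of [Perry2022]'s proof of Prop. 8.1 — «there exists a surjective étale morphism
`U′ → U` with a point `0′ ∈ U′(ℂ)` mapping to `0` … such that the base change `𝓜°_{U′} → U′` admits a section
taking `0′` to `E_{0′}`» — with «surjective» dropped, the section's value recorded as an object `ℰ` on the base
change, and «`ℰ_{0′} ≃ E₀`» recorded as a roof (on the projective `X₀` every isomorphism of `D(Mod 𝒪_{X₀})`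
between bounded complexes of vector bundles is one: [ThomasonTrobaugh1990] 2.3.1 (d), 2.4.1).
[cite: Perry2022, proof of Prop. 8.1] [cite: ThomasonTrobaugh1990, Prop. 2.3.1 (d)] -/
def PerfectComplexExtendsOverEtaleNbhdAt {𝒳 S : SchemeOver ℂ} (π : 𝒳 ⟶ S) (s₀ : ComplexPoints S)
    (X₀ : SchemeOver ℂ) (e : X₀ ≅ fiberOver π s₀) (E : CochainComplex X₀.left.Modules ℤ) : Prop :=
  ∃ (T : SchemeOver ℂ) (ρ : T ⟶ S) (_ : Etale ρ.left) (t₀ : ComplexPoints T) (_ : AlgPoints.map ρ t₀ = s₀)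
    (ℰ : CochainComplex (familyPullback π ρ).left.Modules ℤ) (_ : IsBoundedVBComplex ℰ)
    (ε : X₀ ≅ fiberOver (familyPullback.snd π ρ) t₀)
    (_ : ε.hom ≫ fiberι (familyPullback.snd π ρ) t₀ ≫ familyPullback.fst π ρ = e.hom ≫ fiberι π s₀)
    (P : CochainComplex X₀.left.Modules ℤ) (_ : IsBoundedVBComplex P)
    (φ : P ⟶ ((Scheme.Modules.pullback (ε.hom ≫ fiberι (familyPullback.snd π ρ) t₀).left).mapHomologicalComplex
      (ComplexShape.up ℤ)).obj ℰ)
    (ψ : P ⟶ E), QuasiIso φ ∧ QuasiIso ψ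

/-- **Derived-liftable universally gluable perfect complexes on the fibres of `π` ALGEBRAISE** (PREDICATE on a
family `π : 𝒳 ⟶ S`; the OBJECT-LEVEL, `C`-free form of seat p7's `PerfectComplexAlgebraisesLifts C`, ASSUMPTION
BY NAME when taken as a hypothesis): for every `s₀ ∈ S(ℂ)`, model `e : X₀ ≅ 𝒳_{s₀}` and bounded complex of
vector bundles `E` on `X₀` with `Ext^{k}_{D(X₀)}(E,E) = 0` for `k < 0` having the DERIVED small-extension
lifting property at `s₀` (`PerfectLiftsOverArtinianPointsAt`), `E` extends up to quasi-isomorphism over an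
étale neighbourhood of `s₀` (`PerfectComplexExtendsOverEtaleNbhdAt`). ON PAPER, for `π` smooth projective over
a smooth `S`: Lieblich's algebraic l.f.p. stack of universally gluable relatively perfect complexes
[Lieblich2006, Thm. 4.2.1, Prop. 2.1.9] has a smooth atlas `V → 𝓜` with a `ℂ`-point over `[E]`; `V → S` is
smooth there by [EGAIV4, Prop. 17.14.2] fed by the hypothesis (descending the lift to the atlas); a pointed
étale quasi-section [EGAIV4, Cor. 17.16.3 (i)]; strictification on the projective `𝒳 ×_S T`
[ThomasonTrobaugh1990, 2.3.1 (d)] — theory seat 3's (D1)–(D5). THE KERNEL LINKS IT TO NOTHING (F-1).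
[cite: Lieblich2006, Thm. 4.2.1] [cite: EGAIV4, Prop. 17.14.2 and Cor. 17.16.3 (i)]
[cite: ThomasonTrobaugh1990, Prop. 2.3.1 (d)] [cite: Perry2022, proof of Prop. 8.1] -/
def PerfectLiftsAlgebraise {𝒳 S : SchemeOver ℂ} (π : 𝒳 ⟶ S) : Prop :=
  ∀ (s₀ : ComplexPoints S) (X₀ : SchemeOver ℂ) (e : X₀ ≅ fiberOver π s₀)
    (E : CochainComplex X₀.left.Modules ℤ), IsBoundedVBComplex E →
    (∀ k : ℤ, k < 0 → extRank X₀ E k = 0) →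
    PerfectLiftsOverArtinianPointsAt π s₀ X₀ e E →
    PerfectComplexExtendsOverEtaleNbhdAt π s₀ X₀ e E

end Defs

/-! ## §3 OBJECT-LEVEL ⟹ CLASS-LEVEL: p7's `PerfectComplexAlgebraisesLifts C` for every `C` (proved) -/

section ObjectToClass

/-- The fibre inclusion `𝒳_s ⟶ 𝒳` over a `ℂ`-point is a MONOMORPHISM of `ℂ`-schemes (base change of the
`ℂ`-point `s : Spec ℂ → S`, a section of `S → Spec ℂ`). [folklore] -/
theorem mono_fiberι {𝒳 S : SchemeOver ℂ} (π : 𝒳 ⟶ S) (s : ComplexPoints S) : Mono (fiberι π s) := by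
  haveI : IsIso (specOver ℂ ℂ).hom := by
    change IsIso (Spec.map (CommRingCat.ofHom (algebraMap ℂ ℂ)))
    rw [Algebra.algebraMap_self, CommRingCat.ofHom_id, Spec.map_id]
    infer_instance
  haveI : Mono (s.left ≫ S.hom) := by rw [Over.w s]; infer_instance
  haveI : Mono s.left := mono_of_mono s.left S.hom
  haveI : Mono (fiberι π s).left := by rw [fiberι_left]; exact pullback.fst_of_mono
  exact Over.mono_of_mono_left _

variable {𝒳 S : SchemeOver ℂ} (π : 𝒳 ⟶ S)

/-- **OBJECT ⟹ CLASSES at `s₀`**: if `E` extends up to quasi-isomorphism over an étale neighbourhood of `s₀`,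
then for every Chern character theory `C` the étale data carry the CLASS identity of p7's
`PerfectComplexAlgebraisesLifts C` in every degree `p`. (The compatibility of `ε` with `e` through `𝒳` is
turned into `ε ≫ ((𝒳 ×_S T)_{t₀} ≅ 𝒳_{s₀}) = e` by cancelling the monomorphism `ι_{s₀}`; then §1.)
[cite: Fulton1998, §15.1 (ii)] [cite: Schlichting2011HigherKTheory, Exercise 3.1.4] -/
theorem PerfectComplexExtendsOverEtaleNbhdAt.exists_fiberClass_eq (C : ChernCharacterBetti) {s₀ : ComplexPoints S}
    {X₀ : SchemeOver ℂ} {e : X₀ ≅ fiberOver π s₀} {E : CochainComplex X₀.left.Modules ℤ}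
    (h : PerfectComplexExtendsOverEtaleNbhdAt π s₀ X₀ e E) (hE : IsBoundedVBComplex E) :
    ∃ (T : SchemeOver ℂ) (ρ : T ⟶ S) (_ : Etale ρ.left) (t₀ : ComplexPoints T)
      (_ : AlgPoints.map ρ t₀ = s₀)
      (ℰ : CochainComplex (familyPullback π ρ).left.Modules ℤ) (hℰ : IsBoundedVBComplex ℰ),
      ∀ p : ℕ,
        FiberClass.baseChange π ρ (2 * p)
            (globalSection (familyPullback.snd π ρ) (2 * p)
              (chPerfect C (familyPullback π ρ) ℰ hℰ.isFiniteLocallyFree p) t₀) =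
          ⟨s₀, complexBetti.map e.inv (2 * p) (chPerfect C X₀ E hE.isFiniteLocallyFree p)⟩ := by
  obtain ⟨T, ρ, hρ, t₀, ht₀, ℰ, hℰ, ε, hε, P, hP, φ, ψ, hφ, hψ⟩ := h
  subst ht₀
  -- `ε ≫ ι_{t₀} ≫ pr_𝒳 = e ≫ ι` and `iso ≫ ι = ι_{t₀} ≫ pr_𝒳` give `ε ≫ iso = e` (cancel the mono `ι`)
  have hεe : ε.hom ≫ (fiberOverFamilyPullbackIso π ρ t₀).hom = e.hom := by
    haveI := mono_fiberι π (AlgPoints.map ρ t₀)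
    rw [← cancel_mono (fiberι π (AlgPoints.map ρ t₀)), Category.assoc, fiberOverFamilyPullbackIso_hom_fiberι]
    exact hε
  exact ⟨T, ρ, hρ, t₀, rfl, ℰ, hℰ, fun p =>
    fiberClass_baseChange_chPerfect_eq_of_quasiIso C π ρ t₀ X₀ e ε hεe E hE ℰ hℰ P hP φ ψ p⟩

/-- **`(∀ smooth projective π over a smooth base, PerfectLiftsAlgebraise π) ⟹ PerfectComplexAlgebraisesLifts C`
for EVERY Chern character theory `C`** (PROVED): the object-level, `C`-free assumption implies seat p7's
class-level one. [cite: Perry2022, proof of Prop. 8.1] [cite: Fulton1998, §15.1 (ii)] -/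
theorem perfectComplexAlgebraisesLifts_of_perfectLiftsAlgebraise
    (h : ∀ ⦃𝒳 S : SchemeOver ℂ⦄ (π : 𝒳 ⟶ S) (n : ℕ),
      IsSmoothProjectiveFamily π n → _root_.AlgebraicGeometry.Smooth S.hom → PerfectLiftsAlgebraise π)
    (C : ChernCharacterBetti) : PerfectComplexAlgebraisesLifts C := by
  intro 𝒳 S π n hπ hS s₀ X₀ e E hE hneg hlift
  obtain ⟨T, ρ, hρ, t₀, ht₀, ℰ, hℰ, hch⟩ :=
    (h π n hπ hS s₀ X₀ e E hE hneg hlift).exists_fiberClass_eq π C hE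
  exact ⟨T, ρ, hρ, t₀, ht₀, ℰ, hℰ, hch⟩

end ObjectToClass

/-! ## §4 g = 4: p7's σ-certificate row on `PridhamPerfectLifts C` + the OBJECT-LEVEL algebraisation -/

section FourSplit

variable {C : ChernCharacterBetti}

/-- **g = 4, route (C), σ-TIER, with the Hodge-free half stated at the OBJECT level.** BY NAME:
`weilFamilyReach_hyperbolic` (Deligne, refereed tree fact), `PridhamPerfectLifts C` (the printed, refereed
statement [Pridham2024Semiregularity] Cor. 2.25 + Rem. 2.27, venture-typed by seat p7) and — in place of
`PerfectComplexAlgebraisesLifts C` — the `C`-free `PerfectLiftsAlgebraise π` for smooth projective `π` over a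
smooth base (assumption by name; printed shape [Perry2022] proof of Prop. 8.1). BY VALUE: verbatim p7's
`weilFourfoldsSplit_of_reach_of_pridhamPerfect_of_algebraisesLifts_of_complex`. Conclusion:
`Stubs.WeilAlgebraicSplitHyperplane 2 d` (in print: [Markman2023GeneralizedKummers] Thm. 1.5 (= Thm. 13.4; J. Eur. Math. Soc. 25 (2023) p. 236; pre-publication arXiv numbering: Thm. 1.3);
re-derived, no new case). [cite: Markman2023GeneralizedKummers, Theorem 1.5 (= Theorem 13.4), p. 236 (the case in print; arXiv:1805.11574 pre-publication numbering: Theorem 1.3)]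
[cite: Pridham2024Semiregularity, Cor. 2.25; Rem. 2.27] [cite: Perry2022, proof of Prop. 8.1]
[cite: Deligne1982HodgeCycles, proof of Thm. 4.8] -/
theorem weilFourfoldsSplit_of_reach_of_pridhamPerfect_of_perfectLiftsAlgebraise_of_complex
    (hF : weilFamilyReach_hyperbolic) (hP : PridhamPerfectLifts C)
    (hA : ∀ ⦃𝒳 S : SchemeOver ℂ⦄ (π : 𝒳 ⟶ S) (n : ℕ),
      IsSmoothProjectiveFamily π n → _root_.AlgebraicGeometry.Smooth S.hom → PerfectLiftsAlgebraise π)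
    {d : ℕ} (hd : 0 < d)
    (P : AbelianVariety ℂ) (ψ₀ : P ⟶ P) (e : ProjectiveEmbedding P.X) (a : complexBetti (projectiveSpace e.n ℂ) 2)
    (hP4 : P.dim = 2 * 2) (hψ : ψ₀ ≫ ψ₀ = -(d • 𝟙 P)) (ha : IsRationalClass a) (ha0 : a ≠ 0)
    (hhyp : IsHyperbolicWeilType P ψ₀ 2 (symmetrisedClass d P ψ₀ e a))
    (w : complexBetti P.X (2 * 2)) (hwW : w ∈ weilClassesOf P ψ₀ 2 d) (hwr : IsRationalClass w) (hw0 : w ≠ 0)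
    (I : Finset ℕ) (hI : ∀ p : ℕ, 1 ≤ p → p ≤ 2 * 2 → p ∈ I) (E : CochainComplex P.X.left.Modules ℤ)
    (hE : IsBoundedVBComplex E) (hneg : ∀ k : ℤ, k < 0 → extRank P.X E k = 0) (h0 : extRank P.X E 0 = 1)
    (a' b' : ℤ) [E.IsStrictlyGE a'] [E.IsStrictlyLE b']
    (hσ : letI := HasDerivedCategory.standard P.X.left.Modules
      HomComplex.IsISemiregularC P.X E a' b' hE.isFiniteLocallyFree {q | q + 1 ∈ I})
    (q : ℚ) (c : ℕ → ℚ)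
    (hch2 : chPerfect C P.X E hE.isFiniteLocallyFree 2 = ((q : ℚ) : ℂ) • cupPowTwo (symmetrisedClass d P ψ₀ e a) 2 + w)
    (hchp : ∀ p ∈ I, p ≠ 2 →
      chPerfect C P.X E hE.isFiniteLocallyFree p = ((c p : ℚ) : ℂ) • cupPowTwo (symmetrisedClass d P ψ₀ e a) p) :
    Stubs.WeilAlgebraicSplitHyperplane 2 d :=
  weilFourfoldsSplit_of_reach_of_pridhamPerfect_of_algebraisesLifts_of_complex hF hP
    (perfectComplexAlgebraisesLifts_of_perfectLiftsAlgebraise hA C) hd P ψ₀ e a hP4 hψ ha ha0 hhyp w hwW hwr hw0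
    I hI E hE hneg h0 a' b' hσ q c hch2 hchp

end FourSplit

/-! ## Audit: what is assumed, what is proved
ASSUMED BY NAME in §4: `weilFamilyReach_hyperbolic` (refereed), `PridhamPerfectLifts C` (printed + refereed
statement, venture-typed, undischarged), `PerfectLiftsAlgebraise π` (Hodge-free, OBJECT level, kernel-linked to
nothing) — and the census object BY VALUE. PROVED: §1 (object ⟹ classes at a point of any base change), §3
(`PerfectLiftsAlgebraise` for all smooth projective `π` over smooth bases ⟹ p7's `PerfectComplexAlgebraisesLifts C`,
every `C`). NOT here: the derivation of `PerfectLiftsAlgebraise π` from a versal chart + EGA IV 17 (theory seat 3's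
(D1)–(D5), a Sunday item), HC_CM, CM density, Mumford–Tate finiteness. -/

end Summit.Ventures.HSemireg

end
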